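import Literature.AlgebraicTopology.Homotopy.UnreducedSuspension
import Mathlib.Topology.Category.TopCat.Basic
import HarnessLib

/-!
# Iterated unreduced suspensions

The `N`-fold unreduced suspension `SᴺP = S(S(⋯ S P))` of a space `P`
(Hatcher, *Algebraic Topology* (2002), Ch. 0 p. 8), iterating
`Literature/AlgebraicTopology/Homotopy/UnreducedSuspension.lean`, as a bundled `TopCat` defined
by recursion (`suspN P N`), with:

* `suspN.κ N : P × [0,1]ᴺ → SᴺP`, the iterated quotient map `(p, t) ↦ [[⋯[[p, t₀], t₁]⋯], t_{N-1}]`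
  (continuous), which FORGETS `p` as soon as one coordinate is a pole:
  `κ N (p, t) = κ N (p', t)` if some `tᵢ ∈ {0, 1}` (`κ_eq_of_exists`);
* `suspN.ι N : P × (0,1)ᴺ → SᴺP`, its restriction to the open cube — an OPEN EMBEDDING
  (`isOpenEmbedding_ι`; each suspension step is the homeomorphism `midHomeomorph` onto the open
  middle part), with `κ = ι` on the open cube (`κ_eq_ι`);
* hence `κ` is injective on `P × (0,1)ᴺ` and a point `κ N (p, t)` with `t` in the open cube is
  not of the form `κ N (p', t')` with `t'` touching a pole (`κ_ne_κ_of_mem_of_not_mem`).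

These are the point-set ingredients of the Pontryagin–Thom-type map `S^{d+N} → Sᴺ Ŵ` used for
the evenness of the intersection form of an almost closed framed manifold. Everything is proved;
no named facts.

## References

* A. Hatcher, *Algebraic Topology*, CUP 2002, Ch. 0 p. 8. [Hatcher2002]
-/

noncomputable section

open unitInterval Set Function
open _root_.Topology

universe u

namespace Literature.AlgebraicTopology.Homotopy

variable (P : Type u) [TopologicalSpace P]

/-- **The `N`-fold unreduced suspension** `SᴺP`, `S⁰P = P`, `Sⁿ⁺¹P = S(SⁿP)` (Hatcher 2002,
Ch. 0 p. 8), bundled in `TopCat` so that the recursion carries the topology. [cite: Hatcher2002, Ch. 0 p. 8] -/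
def suspN : ℕ → TopCat.{u}
  | 0 => TopCat.of P
  | n + 1 => TopCat.of (Susp (suspN n))

namespace suspN

/-- `S⁰P = P`. [folklore] -/
lemma zero_eq : (suspN P 0 : Type u) = P := rfl

/-- `Sⁿ⁺¹P = S(SⁿP)`. [folklore] -/
lemma succ_eq (n : ℕ) : (suspN P (n + 1) : Type u) = Susp (suspN P n) := rfl

/-- Iterated suspensions of a nonempty space are nonempty. [folklore] -/
instance instNonempty [Nonempty P] : ∀ n, Nonempty (suspN P n)
  | 0 => ‹Nonempty P›
  | n + 1 => by
    haveI := instNonempty n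
    exact (inferInstance : Nonempty (Susp (suspN P n)))

/-- Iterated suspensions of a compact space are compact. [folklore] -/
instance instCompactSpace [CompactSpace P] : ∀ n, CompactSpace (suspN P n)
  | 0 => ‹CompactSpace P›
  | n + 1 => by
    haveI := instCompactSpace n
    exact (inferInstance : CompactSpace (Susp (suspN P n)))

variable {P}

/-- **The iterated quotient map** `κ N : P × [0,1]ᴺ → SᴺP`,
`κ (n+1) (p, t) = [κ n (p, init t), t (last n)]`. [cite: Hatcher2002, Ch. 0 p. 8] -/
def κ : ∀ N : ℕ, P × (Fin N → I) → suspN P N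
  | 0 => fun x => x.1
  | n + 1 => fun x => Susp.mk (κ n (x.1, Fin.init x.2), x.2 (Fin.last n))

/-- `κ 0 (p, t) = p`. [folklore] -/
@[simp] lemma κ_zero (x : P × (Fin 0 → I)) : κ 0 x = x.1 := rfl

/-- `κ (n+1) (p, t) = [κ n (p, init t), t (last n)]`. [folklore] -/
lemma κ_succ (n : ℕ) (x : P × (Fin (n + 1) → I)) :
    κ (n + 1) x = Susp.mk (κ n (x.1, Fin.init x.2), x.2 (Fin.last n)) := rfl

/-- `κ` is continuous. [folklore] -/
lemma continuous_κ : ∀ N : ℕ, Continuous (κ (P := P) N)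
  | 0 => continuous_fst
  | n + 1 => by
    change Continuous fun x : P × (Fin (n + 1) → I) =>
      Susp.mk (κ n (x.1, Fin.init x.2), x.2 (Fin.last n))
    exact Susp.continuous_mk.comp (((continuous_κ n).comp
      (continuous_fst.prodMk continuous_snd.finInit)).prodMk
        ((continuous_apply (Fin.last n)).comp continuous_snd))

/-- **`κ` forgets the point of `P` at the poles**: if some coordinate of `t` is `0` or `1` then
`κ N (p, t) = κ N (p', t)`. [cite: Hatcher2002, Ch. 0 p. 8] -/
lemma κ_eq_of_exists : ∀ (N : ℕ) (p p' : P) (t : Fin N → I),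
    (∃ i, t i = 0 ∨ t i = 1) → κ N (p, t) = κ N (p', t)
  | 0, _, _, _, ⟨i, _⟩ => i.elim0
  | n + 1, p, p', t, ⟨i, hi⟩ => by
    rw [κ_succ, κ_succ]
    by_cases hlast : t (Fin.last n) = 0 ∨ t (Fin.last n) = 1
    · rcases hlast with h | h
      · exact Susp.mk_eq_mk_iff.2 (Or.inr (Or.inl ⟨h, h⟩))
      · exact Susp.mk_eq_mk_iff.2 (Or.inr (Or.inr ⟨h, h⟩))
    · -- the pole coordinate is among the first `n`
      have hi' : (i : ℕ) ≠ n := by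
        intro e
        have : i = Fin.last n := Fin.ext e
        exact hlast (this ▸ hi)
      have hlt : (i : ℕ) < n := lt_of_le_of_ne (Nat.lt_succ_iff.1 i.2) hi'
      have key : κ n (p, Fin.init t) = κ n (p', Fin.init t) :=
        κ_eq_of_exists n p p' (Fin.init t) ⟨⟨i, hlt⟩, by
          change t (Fin.castSucc ⟨i, hlt⟩) = 0 ∨ t (Fin.castSucc ⟨i, hlt⟩) = 1
          have : Fin.castSucc (⟨i, hlt⟩ : Fin n) = i := Fin.ext rfl
          rw [this]; exact hi⟩
      change Susp.mk (κ n (p, Fin.init t), t (Fin.last n)) =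
        Susp.mk (κ n (p', Fin.init t), t (Fin.last n))
      rw [key]

/-! ### The open cube embeds openly -/

/-- **The open part** `ι N : P × (0,1)ᴺ → SᴺP`, `κ` on the open cube. [folklore] -/
def ι (N : ℕ) (x : P × (Fin N → Susp.midHeights)) : suspN P N :=
  κ N (x.1, fun i => (x.2 i).1)

/-- `κ = ι` on the open cube. [folklore] -/
lemma κ_eq_ι (N : ℕ) (p : P) (t : Fin N → Susp.midHeights) :
    κ N (p, fun i => (t i).1) = ι N (p, t) := rfl

/-- `ι 0 (p, t) = p`. [folklore] -/
@[simp] lemma ι_zero (x : P × (Fin 0 → Susp.midHeights)) : ι 0 x = x.1 := rfl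

/-- The suspension step on the open middle: `(q, s) ↦ [q, s]` is an open embedding
`Q × (0,1) → SQ`. [folklore] -/
lemma isOpenEmbedding_mk_mid (Q : Type u) [TopologicalSpace Q] :
    IsOpenEmbedding (fun x : Q × Susp.midHeights => Susp.mk (x.1, x.2.1)) := by
  have h : (fun x : Q × Susp.midHeights => Susp.mk (x.1, x.2.1)) =
      Subtype.val ∘ (Susp.midHomeomorph (P := Q)) := by
    funext x; rfl
  rw [h]
  exact Susp.isOpen_middle.isOpenEmbedding_subtypeVal.comp Susp.midHomeomorph.isOpenEmbedding

/-- **The suspension of a Hausdorff space is Hausdorff**: points of different heights are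
separated by the height; points of the same height strictly between the poles by the open
embedding of `Q × (0,1)`; two points at the same pole coincide. [folklore] -/
instance _root_.Literature.AlgebraicTopology.Homotopy.Susp.instT2Space (Q : Type u)
    [TopologicalSpace Q] [T2Space Q] : T2Space (Susp Q) := by
  rw [t2Space_iff]
  intro z z' hzz'
  by_cases hh : Susp.height z = Susp.height z'
  · induction z using Susp.ind with
    | h x =>
      induction z' using Susp.ind with
      | h x' =>
        change x.2 = x'.2 at hh
        by_cases hmid : x.2 ∈ Susp.midHeights
        · -- same height strictly between the poles
          have hne : ((x.1, ⟨x.2, hmid⟩) : Q × Susp.midHeights) ≠ (x'.1, ⟨x'.2, hh ▸ hmid⟩) := by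
            intro e
            apply hzz'
            simp only [Prod.mk.injEq, Subtype.mk.injEq] at e
            rw [show x = x' from Prod.ext e.1 e.2]
          obtain ⟨u, v, hu, hv, hxu, hxv, huv⟩ := separated_by_isOpenEmbedding
            (isOpenEmbedding_mk_mid Q) hne
          exact ⟨u, v, hu, hv, hxu, hxv, huv⟩
        · -- both at the same pole
          exfalso
          apply hzz'
          have h01 : x.2 = 0 ∨ x.2 = 1 := by
            by_contra hc
            push Not at hc
            exact hmid ⟨lt_of_le_of_ne x.2.2.1 (fun e => hc.1 (Subtype.ext e.symm)),
              lt_of_le_of_ne x.2.2.2 (fun e => hc.2 (Subtype.ext e))⟩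
          rcases h01 with h0 | h1
          · exact Susp.mk_eq_mk_iff.2 (Or.inr (Or.inl ⟨h0, hh ▸ h0⟩))
          · exact Susp.mk_eq_mk_iff.2 (Or.inr (Or.inr ⟨h1, hh ▸ h1⟩))
  · exact separated_by_continuous Susp.height.continuous hh

/-- Iterated suspensions of a Hausdorff space are Hausdorff. [folklore] -/
instance instT2Space [T2Space P] : ∀ n, T2Space (suspN P n)
  | 0 => ‹T2Space P›
  | n + 1 => by
    haveI := instT2Space n
    exact (inferInstance : T2Space (Susp (suspN P n)))

/-- Splitting off the last open-cube coordinate, a homeomorphism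
`P × (0,1)ⁿ⁺¹ ≃ₜ (P × (0,1)ⁿ) × (0,1)`. [folklore] -/
def splitLast (n : ℕ) (Y : Type) [TopologicalSpace Y] :
    P × (Fin (n + 1) → Y) ≃ₜ (P × (Fin n → Y)) × Y where
  toFun x := ((x.1, Fin.init x.2), x.2 (Fin.last n))
  invFun y := (y.1.1, Fin.snoc y.1.2 y.2)
  left_inv x := by simp
  right_inv y := by simp
  continuous_toFun := (continuous_fst.prodMk continuous_snd.finInit).prodMk
    ((continuous_apply (Fin.last n)).comp continuous_snd)
  continuous_invFun := continuous_fst.fst.prodMk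
    (Continuous.finSnoc (continuous_fst.snd) continuous_snd)

/-- `ι (n+1)` factors as `splitLast`, then `ι n × id`, then the suspension step. [folklore] -/
lemma ι_succ_eq (n : ℕ) :
    ι (P := P) (n + 1) = (fun x : suspN P n × Susp.midHeights => Susp.mk (x.1, x.2.1)) ∘
      Prod.map (ι n) id ∘ splitLast n Susp.midHeights := by
  funext x
  rfl

/-- **The open cube embeds openly**: `ι N : P × (0,1)ᴺ → SᴺP` is an open embedding.
[cite: Hatcher2002, Ch. 0 p. 8] -/
theorem isOpenEmbedding_ι : ∀ N : ℕ, IsOpenEmbedding (ι (P := P) N)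
  | 0 => by
    have h : ι (P := P) 0 = Prod.fst := rfl
    rw [h]
    exact (Homeomorph.prodUnique P (Fin 0 → Susp.midHeights)).isOpenEmbedding
  | n + 1 => by
    rw [ι_succ_eq]
    exact ((isOpenEmbedding_mk_mid _).comp ((isOpenEmbedding_ι n).prodMap IsOpenEmbedding.id)).comp
      (splitLast n Susp.midHeights).isOpenEmbedding

/-- `ι` is injective. [folklore] -/
lemma ι_injective (N : ℕ) : Injective (ι (P := P) N) := (isOpenEmbedding_ι N).injective

/-- The image of the open cube is open. [folklore] -/
lemma isOpen_range_ι (N : ℕ) : IsOpen (range (ι (P := P) N)) :=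
  (isOpenEmbedding_ι N).isOpen_range

/-- The last height of `κ (n+1) (p, t)` is `t (last n)`. [folklore] -/
lemma height_κ_succ (n : ℕ) (x : P × (Fin (n + 1) → I)) :
    Susp.height (κ (n + 1) x) = x.2 (Fin.last n) := rfl

/-- **Points over the open cube are not pole-type points**: if `t` lies in the open cube and
`t'` does not, then `κ N (p, t) ≠ κ N (p', t')`. [folklore] -/
lemma κ_ne_κ_of_mem_of_not_mem : ∀ (N : ℕ) (p p' : P) (t t' : Fin N → I),
    (∀ i, t i ∈ Susp.midHeights) → (∃ i, t' i ∉ Susp.midHeights) → κ N (p, t) ≠ κ N (p', t')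
  | 0, _, _, _, _, _, ⟨i, _⟩ => i.elim0
  | n + 1, p, p', t, t', ht, ⟨i, hi⟩ => by
    intro h
    have hh : t (Fin.last n) = t' (Fin.last n) := by
      have := congrArg Susp.height h
      rwa [height_κ_succ, height_κ_succ] at this
    by_cases hin : (i : ℕ) = n
    · have : i = Fin.last n := Fin.ext hin
      subst this
      exact hi (hh ▸ ht (Fin.last n))
    · have hlt : (i : ℕ) < n := lt_of_le_of_ne (Nat.lt_succ_iff.1 i.2) hin
      rw [κ_succ, κ_succ] at h
      have h' := Susp.eq_of_mk_eq h (Susp.ne_zero_of_mem_midHeights (ht _))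
        (Susp.ne_one_of_mem_midHeights (ht _))
      have hinit : κ n (p, Fin.init t) = κ n (p', Fin.init t') := congrArg Prod.fst h'
      exact κ_ne_κ_of_mem_of_not_mem n p p' (Fin.init t) (Fin.init t')
        (fun j => ht (Fin.castSucc j)) ⟨⟨i, hlt⟩, by
          change t' (Fin.castSucc ⟨i, hlt⟩) ∉ Susp.midHeights
          have : Fin.castSucc (⟨i, hlt⟩ : Fin n) = i := Fin.ext rfl
          rw [this]; exact hi⟩ hinit

/-- **`κ` is injective over the open cube**: `κ N (p, t) = κ N (p', t')` with `t, t'` in the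
open cube forces `(p, t) = (p', t')`. [folklore] -/
lemma κ_injOn (N : ℕ) {p p' : P} {t t' : Fin N → I} (ht : ∀ i, t i ∈ Susp.midHeights)
    (ht' : ∀ i, t' i ∈ Susp.midHeights) (h : κ N (p, t) = κ N (p', t')) : p = p' ∧ t = t' := by
  have e : ι N (p, fun i => ⟨t i, ht i⟩) = ι N (p', fun i => ⟨t' i, ht' i⟩) := h
  have := ι_injective N e
  simp only [Prod.mk.injEq] at this
  refine ⟨this.1, funext fun i => ?_⟩
  exact congrArg Subtype.val (congrFun this.2 i)

end suspN

end Literature.AlgebraicTopology.Homotopy
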